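import Mathlib
import Literature.NumberTheory.LFunctions.Zhang2022.Section13ZeroSumQuadratic
import Literature.NumberTheory.LFunctions.Zhang2022.Section13MeanSquaresParams
import Literature.NumberTheory.LFunctions.Zhang2022.Section13ChainClosed
import HarnessLib

/-!
# Zhang (2022) §13 p. 75: the Lemma-4.8 remainder of the repaired (13.7),
# `𝓛⁻¹⁰⁰·ΣΣ‖L(ρ+β₁,ψ)N(ρ+β₂,ψ)N(ρ+β₃,ψ)B(ρ,ψ)/L′(ρ,ψ)‖·|ω(ρ)| = o((𝔞+1)𝔓)` — `Rem137`, kernel-proved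

Topic `Literature/NumberTheory/LFunctions/Zhang2022` (Landau–Siegel audit tree; verdict-neutral).
Y. Zhang, *Discrete mean estimates and the Landau–Siegel zero*, arXiv:2211.02515v1 (2022)
[Zhang2022LandauSiegel], §13 (13.7), (13.11) p. 75 (tex L3774–L3817) — an unrefereed manuscript under
adjudication; nothing here asserts or denies its Theorems 1–2. Lane ZHANG-L (WP14): ruling R-19
(DISCHARGE-BY-BYPASS of the leaf `Skeleton.Eq137 c′ c₀`, whose printed error term omits the Lemma-4.8
remainder, GAP row G-L3t6-2) asks for this estimate OUTRIGHT; it is hypothesis #2 of the tree edge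
`Typed.Section13.eval137Rel_of_repaired` (`Section13ChainClosed`).

The remainder is a (13.11)-type discrete mean value ("Combining (2.34), Cauchy's inequality, …, Lemma 5.9,
6.1 and 3.3"), handled by the lane's §13 infrastructure:

* the summand is `w(ρ,ψ)·|N(ρ+β₂,ψ)N(ρ+β₃,ψ)|·|B(ρ,ψ)|` with the POSITIVE weight
  `w = |L(ρ+β₁,ψ)/L′(ρ,ψ)|·|ω(ρ)|`; Cauchy's inequality on the `(ψ,ρ)`-sum;
* both quadratic zero-sums are instances of `zeroSum_dirPoly_sq_le_of_prop22`
  (`Section13ZeroSumQuadratic`: (2.34)/residue conversion + Lemma 5.9 on `𝒥(±α)` + Lemma 3.3 (i) by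
  orthogonality, `𝔓`-form): `N(ρ+β₂,ψ)N(ρ+β₃,ψ) = Σ_{k≤P} c₁(k)ψ(k)k^{−ρ}`, `c₁ = u₂′ ⋆ u₃′`,
  `u_j(n) = g*(T²/n)n^{−β_j}` truncated at `2T²` (`Nchar_shift_eq_dirPoly` of `Section13MeanSquaresParams`, `dirPoly_mul_dirPoly_eq`,
  `(2T²)² ≤ P`), and `B(ρ,ψ) = Σ_{k≤P} b(k)χ(k)·ψ(k)k^{−ρ}` ((15.1), `Skeleton.Bpoly_eq_sum_bcoef`);
* the logarithmic coefficient sums `Σ|c₁|²/k ≤ majorantConst 4 2·(log 2T²)⁴`,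
  `Σ|bχ|²/k ≤ β²·majorantConst 4 4·(log P)⁴` (`Section13MeanSquareTools`), `(log ⌈2T²⌉)⁴ ≤ 3⁴𝓛⁸`,
  `(log P)⁴ = 𝓛³⁶`; the `e^{−𝓛¹⁰/8}`-terms are `≤ 𝔓` for `𝓛 ≥ 80`.

Results: `rem137_core_of_prop22` — for `c′ ≥ 0` with `Skeleton.Prop22 c′`:
`ΣΣ‖L(ρ+β₁)N(ρ+β₂)N(ρ+β₃)B/L′(ρ)‖·|ω(ρ)| ≤ C·𝔓·𝓛³¹` for all large `D` (EXPLICIT exponent `31 < 100`,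
no Assumption (A)); `rem137_of_prop22`, `rem137_eventually` — the `ε(𝔞+1)𝔓` forms (hypothesis #2 of
`eval137Rel_of_repaired` verbatim); `eval137Rel_of_1311Rel_le` — the h137 BYPASS EDGE without the
named constant: `∃ c₁ > 0, ∃ k, ∀ c₀ ≤ c₁, ∀ c′ ≥ k, Eq1311Rel c′ c₀ → Eval137Rel c′` (R-19; zl-w14-p5
specialises `c₀ := c137`, R-21). Theorems only: no new definition, no new fact, axioms standard.

## References

* Y. Zhang, arXiv:2211.02515v1 (2022), §13 (13.7), (13.11) p. 75; §4 Lemma 4.8; §6 Lemma 6.1 (`N`);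
  §15 (15.1)–(15.2); §3 Lemma 3.3 (i). [cite: Zhang2022LandauSiegel, §13 p.75]
-/

noncomputable section

open Complex Real Finset ComplexConjugate

namespace Literature.NumberTheory.LFunctions.Zhang2022.Typed.Section13

open Skeleton GammaFactor Section8aStatements MeanSquareMajorant Section7Eq75

/-! ## A. `N(ρ+β_j,ψ)`, `N(ρ+β₂,ψ)N(ρ+β₃,ψ)` and `B(ρ,ψ)` as `ψ`-polynomials `Σ_{k≤P} c(k)ψ(k)k^{−ρ}` -/

section Identities

variable (c' : ℝ) {D : ℕ} [NeZero D] (χ : DirichletCharacter ℂ D) (x : Chr D)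

omit [NeZero D] χ in
/-- **`N(ρ+β₂,ψ)N(ρ+β₃,ψ) = Σ_{1≤k≤⌊P⌋} c₁(k)ψ(k)k^{−ρ}`**, `c₁ = u₂′ ⋆ u₃′` the convolution of the
truncated coefficient sequences `u_j(n) = g*(T²/n)n^{−β_j}·[n < ⌈2T²⌉]` — once `(⌈2T²⌉−1)² ≤ ⌊P⌋`.
[cite: Zhang2022LandauSiegel, §13 p.75; §6 Lemma 6.1] -/
theorem Nchar_mul_Nchar_eq_dirPoly
    (hK : (⌈2 * bigT D ^ 2⌉₊ - 1) * (⌈2 * bigT D ^ 2⌉₊ - 1) ≤ ⌊bigP D⌋₊) (ρ : ℂ) :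
    Nchar D (psiFn x) (ρ + beta2 c' D) * Nchar D (psiFn x) (ρ + beta3 c' D) =
      ∑ k ∈ Icc 1 ⌊bigP D⌋₊,
        seqConv
            (fun n : ℕ => if n < ⌈2 * bigT D ^ 2⌉₊ then
              ((gstar D (bigT D ^ 2 / n) : ℝ) : ℂ) * (n : ℂ) ^ (-beta2 c' D) else 0)
            (fun n : ℕ => if n < ⌈2 * bigT D ^ 2⌉₊ then
              ((gstar D (bigT D ^ 2 / n) : ℝ) : ℂ) * (n : ℂ) ^ (-beta3 c' D) else 0) k *
          x.ψ (k : ZMod x.p) * (k : ℂ) ^ (-ρ) := by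
  rw [Nchar_shift_eq_dirPoly x ρ (beta2 c' D), Nchar_shift_eq_dirPoly x ρ (beta3 c' D)]
  exact dirPoly_mul_dirPoly_eq _ _ _ hK
    (fun n : ℕ => ((gstar D (bigT D ^ 2 / n) : ℝ) : ℂ) * (n : ℂ) ^ (-beta2 c' D))
    (fun n : ℕ => ((gstar D (bigT D ^ 2 / n) : ℝ) : ℂ) * (n : ℂ) ^ (-beta3 c' D))
    (fun n : ℕ => x.ψ (n : ZMod x.p)) (fun m n => by rw [Nat.cast_mul, map_mul]) ρ

omit [NeZero D] χ in
/-- `ψ(0) = 0` (modulus `p` prime). [folklore] -/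
private theorem psi_zero : x.ψ ((0 : ℕ) : ZMod x.p) = 0 := by
  haveI : Fact (1 < x.p) := ⟨x.prime.one_lt⟩
  rw [Nat.cast_zero, MulChar.map_zero]

omit [NeZero D] in
/-- **(15.1) on `1 ≤ k ≤ ⌊P⌋`: `B(ρ,ψ) = Σ_{1≤k≤⌊P⌋} [b(k)χ(k)]·ψ(k)k^{−ρ}`** (`Skeleton.Bpoly_eq_sum_bcoef`;
support of `b` below `PT⁻² ≤ ⌊P⌋+1`, the `k = 0` term vanishes; `𝓛 ≥ 3`).
[cite: Zhang2022LandauSiegel, §15 (15.1)–(15.2) p.79] -/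
theorem Bpoly_eq_dirPolyIcc (hD : 3 ≤ ell D) (ρ : ℂ) :
    Bpoly χ x ρ = ∑ k ∈ Icc 1 ⌊bigP D⌋₊,
      (bcoef D k * χ (k : ZMod D)) * x.ψ (k : ZMod x.p) * (k : ℂ) ^ (-ρ) := by
  have hP0 : 0 ≤ bigP D := (Real.exp_pos _).le
  have hT1 : 1 ≤ bigT D ^ 2 :=
    one_le_pow₀ (by rw [bigT]; exact Real.one_le_exp (Real.rpow_nonneg (Real.log_natCast_nonneg D) _))
  have hN : bigP D / bigT D ^ 2 ≤ ((⌊bigP D⌋₊ + 1 : ℕ) : ℝ) := by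
    calc bigP D / bigT D ^ 2 ≤ bigP D := div_le_self hP0 hT1
      _ ≤ ((⌊bigP D⌋₊ + 1 : ℕ) : ℝ) := by push_cast; exact (Nat.lt_floor_add_one _).le
  rw [Bpoly_eq_sum_bcoef χ x hD hN ρ]
  have hsub : Icc 1 ⌊bigP D⌋₊ ⊆ Finset.range (⌊bigP D⌋₊ + 1) := fun k hk => by
    rw [Finset.mem_Icc] at hk
    exact Finset.mem_range.mpr (by omega)
  rw [← Finset.sum_subset hsub (f := fun k => bcoef D k * pc χ x k * (k : ℂ) ^ (-ρ)) ?_]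
  · refine Finset.sum_congr rfl fun k _ => ?_
    rw [pc]; ring
  · intro k hk hk'
    rw [Finset.mem_range] at hk
    rw [Finset.mem_Icc, not_and_or, not_le] at hk'
    have hk0 : k = 0 := by omega
    subst hk0
    rw [pc, psi_zero]
    ring

end Identities

/-! ## B. Sizes of the coefficient sequences -/

section Coefficients

variable (c' : ℝ) {D : ℕ}

/-- The truncated `N`-coefficients are dominated by the `⌈2T²⌉`-smooth indicator:
`u_j′ ≪ 1·smoothIndLE ⌈2T²⌉` (`|g*| ≤ 1`, `Re β_j = 0`; `Section13MeanSquareTools.dom_trunc_unimodular`).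
[cite: Zhang2022LandauSiegel, §6 Lemma 6.1 p.30] -/
theorem dom_Ncoeff (hℓ : 0 < ell D) {β : ℂ} (hβ : β.re = 0) :
    Dom (fun n : ℕ => if n < ⌈2 * bigT D ^ 2⌉₊ then
        ((gstar D (bigT D ^ 2 / n) : ℝ) : ℂ) * (n : ℂ) ^ (-β) else 0) 1 (smoothIndLE ⌈2 * bigT D ^ 2⌉₊) :=
  dom_trunc_unimodular (fun _ => norm_gstar_le_one hℓ _) hβ _

/-- Uniform size of a truncated `N`-coefficient: `‖u_j′(n)‖ ≤ 1` (all `n`).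
[cite: Zhang2022LandauSiegel, §6 Lemma 6.1 p.30] -/
theorem norm_Ncoeff_le_one (hℓ : 0 < ell D) {β : ℂ} (hβ : β.re = 0) (n : ℕ) :
    ‖(fun n : ℕ => if n < ⌈2 * bigT D ^ 2⌉₊ then
        ((gstar D (bigT D ^ 2 / n) : ℝ) : ℂ) * (n : ℂ) ^ (-β) else 0) n‖ ≤ 1 := by
  simp only
  split_ifs with h
  · rcases Nat.eq_zero_or_pos n with rfl | hn
    · have h0 : gstar D (bigT D ^ 2 / ((0 : ℕ) : ℝ)) = 0 := by
        rw [Nat.cast_zero, div_zero, gstar, if_neg (by norm_num)]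
      rw [norm_mul, h0]; simp
    · rw [norm_mul, norm_natCast_cpow_neg_of_re_zero hn.ne' hβ, mul_one]
      exact norm_gstar_le_one hℓ _
  · simp

/-- **Uniform size of `c₁ = u₂′ ⋆ u₃′`**: `‖c₁(n)‖ ≤ M²`, `M = ⌈2T²⌉` (`‖c₁(n)‖ ≤ τ₂(n) ≤ n` and `c₁(n) = 0`
for `n ≥ M²`). [cite: Zhang2022LandauSiegel, §13 p.75] -/
theorem norm_NNcoeff_le (hℓ : 0 < ell D) (n : ℕ) :
    ‖seqConv
        (fun n : ℕ => if n < ⌈2 * bigT D ^ 2⌉₊ then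
          ((gstar D (bigT D ^ 2 / n) : ℝ) : ℂ) * (n : ℂ) ^ (-beta2 c' D) else 0)
        (fun n : ℕ => if n < ⌈2 * bigT D ^ 2⌉₊ then
          ((gstar D (bigT D ^ 2 / n) : ℝ) : ℂ) * (n : ℂ) ^ (-beta3 c' D) else 0) n‖ ≤
      ((⌈2 * bigT D ^ 2⌉₊ * ⌈2 * bigT D ^ 2⌉₊ : ℕ) : ℝ) := by
  set M := ⌈2 * bigT D ^ 2⌉₊ with hM
  by_cases hn : n < M * M
  · have h := norm_seqConv_le_tau_two (C₁ := 1) (C₂ := 1) zero_le_one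
      (fun m _ => norm_Ncoeff_le_one hℓ (beta2_re c' D) m)
      (fun m _ => norm_Ncoeff_le_one hℓ (beta3_re c' D) m) n
    rw [one_mul, one_mul, tau_two_apply] at h
    refine h.trans ?_
    have h2 : (n.divisors.card : ℝ) ≤ n := by exact_mod_cast Nat.card_divisors_le_self n
    exact h2.trans (by exact_mod_cast hn.le)
  · rw [not_lt] at hn
    have h0 : seqConv
        (fun n : ℕ => if n < M then ((gstar D (bigT D ^ 2 / n) : ℝ) : ℂ) * (n : ℂ) ^ (-beta2 c' D) else 0)
        (fun n : ℕ => if n < M then ((gstar D (bigT D ^ 2 / n) : ℝ) : ℂ) * (n : ℂ) ^ (-beta3 c' D) else 0)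
        n = 0 := by
      rw [seqConv]
      refine Finset.sum_eq_zero fun q hq => ?_
      have hqn : q.1 * q.2 = n := (Nat.mem_divisorsAntidiagonal.mp hq).1
      by_cases h1 : q.1 < M
      · have h2 : ¬ q.2 < M := by
          intro h2
          have : q.1 * q.2 < M * M := Nat.mul_lt_mul'' h1 h2
          omega
        simp [h2]
      · simp [h1]
    rw [h0, norm_zero]; positivity

/-- **Uniform size of `bχ`**: `‖b(n)χ(n)‖ ≤ β_b·P`, `β_b = (1+|ι₂|)(|ι₃|+|ι₄|)` (`|b(n)| ≤ β_bτ₂(n) ≤ β_b n`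
and `b(n) = 0` for `n ≥ PT⁻²`; `𝓛 ≥ 3`). [cite: Zhang2022LandauSiegel, §15 (15.2) p.79] -/
theorem norm_bcoef_chi_le_P [NeZero D] (χ : DirichletCharacter ℂ D) (hD : 3 ≤ ell D) (n : ℕ) :
    ‖bcoef D n * χ (n : ZMod D)‖ ≤ (1 + ‖iota2‖) * (‖iota3‖ + ‖iota4‖) * bigP D := by
  have hβ : 0 ≤ (1 + ‖iota2‖) * (‖iota3‖ + ‖iota4‖) := by positivity
  have hP0 : 0 ≤ bigP D := (Real.exp_pos _).le
  by_cases hn : bigP D / bigT D ^ 2 ≤ n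
  · rw [bcoef_eq_zero_of_le hD hn, zero_mul, norm_zero]; positivity
  · rw [not_le] at hn
    have hT1 : 1 ≤ bigT D ^ 2 :=
      one_le_pow₀ (by rw [bigT]; exact Real.one_le_exp (Real.rpow_nonneg (Real.log_natCast_nonneg D) _))
    have hnP : (n : ℝ) ≤ bigP D := hn.le.trans (div_le_self hP0 hT1)
    have hdom := dom_bcoef_chi χ (by rw [ell] at hD; linarith)
    rcases Nat.eq_zero_or_pos n with rfl | hpos
    · rw [bcoef, Nat.divisorsAntidiagonal_zero, Finset.sum_empty, zero_mul, norm_zero]; positivity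
    · have h := hdom n hpos.ne'
      refine h.trans (mul_le_mul_of_nonneg_left ?_ hβ)
      rw [tau_two_apply]
      calc (n.divisors.card : ℝ) ≤ n := by exact_mod_cast Nat.card_divisors_le_self n
        _ ≤ bigP D := hnP

end Coefficients

/-! ## C. Sizes for large `D` (`𝓛 ≥ 80`) -/

section Sizes

variable {D : ℕ}

/-- `𝓛^{1.1} ≤ 𝓛²` and `T² ≤ e^{2𝓛²}` for `𝓛 ≥ 1`. [cite: Zhang2022LandauSiegel, §2 (2.6)] -/
private theorem bigT_sq_le (hL : 1 ≤ ell D) : bigT D ^ 2 ≤ Real.exp (2 * ell D ^ 2) := by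
  have h11 : ell D ^ (1.1 : ℝ) ≤ ell D ^ 2 := by
    have h := Real.rpow_le_rpow_of_exponent_le hL (by norm_num : (1.1 : ℝ) ≤ 2)
    rwa [Real.rpow_two] at h
  rw [bigT, ← Real.exp_nat_mul]
  exact Real.exp_le_exp.mpr (by push_cast; linarith)

/-- The length `M = ⌈2T²⌉` of `N`: `2 ≤ M`, `M ≤ 3T²`, `(M−1)² ≤ ⌊P⌋`, `(log M)⁴ ≤ 81𝓛⁸` (`𝓛 ≥ 2`).
[cite: Zhang2022LandauSiegel, §6 Lemma 6.1 p.30; §2 (2.6)] -/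
private theorem sizes_M (hL : 2 ≤ ell D) :
    2 ≤ ⌈2 * bigT D ^ 2⌉₊ ∧ (⌈2 * bigT D ^ 2⌉₊ : ℝ) ≤ 3 * bigT D ^ 2 ∧
      (⌈2 * bigT D ^ 2⌉₊ - 1) * (⌈2 * bigT D ^ 2⌉₊ - 1) ≤ ⌊bigP D⌋₊ ∧
      Real.log (⌈2 * bigT D ^ 2⌉₊ : ℕ) ^ 4 ≤ 81 * ell D ^ 8 := by
  have hL1 : 1 ≤ ell D := by linarith
  have hT1 : 1 ≤ bigT D := by rw [bigT]; exact Real.one_le_exp (Real.rpow_nonneg (by linarith) _)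
  have hT2 : 1 ≤ bigT D ^ 2 := one_le_pow₀ hT1
  have hTsq := bigT_sq_le hL1
  set M := ⌈2 * bigT D ^ 2⌉₊ with hM
  have hM2 : 2 ≤ M := by
    have h : (2 : ℝ) ≤ 2 * bigT D ^ 2 := by linarith
    have h' : (2 : ℝ) ≤ (M : ℝ) := h.trans (Nat.le_ceil _)
    exact_mod_cast h'
  have hMle : (M : ℝ) ≤ 3 * bigT D ^ 2 := by
    have h := Nat.ceil_lt_add_one (by positivity : (0 : ℝ) ≤ 2 * bigT D ^ 2)
    rw [← hM] at h
    linarith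
  have hM1 : ((M - 1 : ℕ) : ℝ) ≤ 2 * bigT D ^ 2 := by
    have h := Nat.ceil_lt_add_one (by positivity : (0 : ℝ) ≤ 2 * bigT D ^ 2)
    rw [← hM] at h
    have hM1' : 1 ≤ M := by omega
    push_cast [Nat.cast_sub hM1']
    linarith
  -- `(M−1)² ≤ 4T⁴ ≤ P`
  have hℓ9 : 4 * ell D ^ 2 + 2 ≤ ell D ^ 9 := by
    have h4 : (4 : ℝ) ≤ ell D ^ 2 := by nlinarith
    have h7 : (128 : ℝ) ≤ ell D ^ 7 := by
      calc (128 : ℝ) = 2 ^ 7 := by norm_num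
        _ ≤ ell D ^ 7 := pow_le_pow_left₀ (by norm_num) hL 7
    have : ell D ^ 9 = ell D ^ 2 * ell D ^ 7 := by ring
    nlinarith
  have hprod : (M - 1) * (M - 1) ≤ ⌊bigP D⌋₊ := by
    refine Nat.le_floor ?_
    push_cast
    calc ((M - 1 : ℕ) : ℝ) * ((M - 1 : ℕ) : ℝ) ≤ (2 * bigT D ^ 2) * (2 * bigT D ^ 2) :=
          mul_le_mul hM1 hM1 (Nat.cast_nonneg _) (by positivity)
      _ ≤ (2 * Real.exp (2 * ell D ^ 2)) * (2 * Real.exp (2 * ell D ^ 2)) := by gcongr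
      _ = 4 * Real.exp (4 * ell D ^ 2) := by
          rw [show (4 : ℝ) * ell D ^ 2 = 2 * ell D ^ 2 + 2 * ell D ^ 2 by ring, Real.exp_add]; ring
      _ ≤ Real.exp 2 * Real.exp (4 * ell D ^ 2) := by
          gcongr
          have h1 := Real.add_one_le_exp (1 : ℝ)
          have h2 : Real.exp 2 = Real.exp 1 * Real.exp 1 := by rw [← Real.exp_add]; norm_num
          nlinarith [Real.exp_pos (1 : ℝ)]
      _ = Real.exp (4 * ell D ^ 2 + 2) := by rw [← Real.exp_add]; ring_nf
      _ ≤ bigP D := by rw [bigP]; exact Real.exp_le_exp.mpr hℓ9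
  -- `(log M)⁴ ≤ (3𝓛²)⁴`
  have hlogM : Real.log (M : ℕ) ≤ 3 * ell D ^ 2 := by
    have hMpos : (0 : ℝ) < (M : ℝ) := by exact_mod_cast (by omega : 0 < M)
    have h3T : Real.log ((M : ℕ) : ℝ) ≤ Real.log (3 * bigT D ^ 2) := Real.log_le_log hMpos hMle
    have hlog3T : Real.log (3 * bigT D ^ 2) ≤ 2 + 2 * ell D ^ 2 := by
      rw [Real.log_mul (by norm_num) (by positivity)]
      have hl3 : Real.log 3 ≤ 2 := by
        rw [Real.log_le_iff_le_exp (by norm_num)]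
        have := Real.add_one_le_exp (2 : ℝ)
        nlinarith [Real.exp_one_gt_d9, Real.exp_one_lt_d9]
      have hlT : Real.log (bigT D ^ 2) ≤ 2 * ell D ^ 2 := by
        rw [Real.log_le_iff_le_exp (by positivity)]; exact hTsq
      linarith
    have h4 : (4 : ℝ) ≤ ell D ^ 2 := by nlinarith
    linarith
  have hlogM0 : 0 ≤ Real.log (M : ℕ) := Real.log_natCast_nonneg M
  refine ⟨hM2, hMle, hprod, ?_⟩
  calc Real.log (M : ℕ) ^ 4 ≤ (3 * ell D ^ 2) ^ 4 := pow_le_pow_left₀ hlogM0 hlogM 4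
    _ = 81 * ell D ^ 8 := by ring

/-- `⌊P⌋`: `2 ≤ ⌊P⌋` and `(log ⌊P⌋)⁴ ≤ 𝓛³⁶` (`𝓛 ≥ 2`). [cite: Zhang2022LandauSiegel, §2 (2.6)] -/
private theorem sizes_P (hL : 2 ≤ ell D) :
    2 ≤ ⌊bigP D⌋₊ ∧ Real.log (⌊bigP D⌋₊ : ℕ) ^ 4 ≤ ell D ^ 36 := by
  have hP0 : 0 ≤ bigP D := (Real.exp_pos _).le
  have h2P : (2 : ℝ) ≤ bigP D := by
    rw [bigP]
    have h9 : (2 : ℝ) ≤ ell D ^ 9 := le_trans hL (le_self_pow₀ (by linarith) (by norm_num))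
    have := Real.add_one_le_exp (ell D ^ 9)
    linarith
  have hfl : 2 ≤ ⌊bigP D⌋₊ := Nat.le_floor (by exact_mod_cast h2P)
  have hpos : (0 : ℝ) < (⌊bigP D⌋₊ : ℕ) := by exact_mod_cast (by omega : 0 < ⌊bigP D⌋₊)
  have hlog : Real.log (⌊bigP D⌋₊ : ℕ) ≤ ell D ^ 9 := by
    calc Real.log (⌊bigP D⌋₊ : ℕ) ≤ Real.log (bigP D) := Real.log_le_log hpos (Nat.floor_le hP0)
      _ = ell D ^ 9 := by rw [bigP, Real.log_exp]
  refine ⟨hfl, ?_⟩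
  calc Real.log (⌊bigP D⌋₊ : ℕ) ^ 4 ≤ (ell D ^ 9) ^ 4 :=
        pow_le_pow_left₀ (Real.log_natCast_nonneg _) hlog 4
    _ = ell D ^ 36 := by ring

/-- The error terms: for `𝓛 ≥ 80`, `(9T⁴·P)²e^{−𝓛¹⁰/8} ≤ 1` and `(P·P)²e^{−𝓛¹⁰/8} ≤ 1`.
[cite: Zhang2022LandauSiegel, §2 (2.6)] -/
private theorem sizes_err (h80 : 80 ≤ ell D) :
    (3 * bigT D ^ 2 * (3 * bigT D ^ 2) * bigP D) ^ 2 * Real.exp (-(ell D ^ 10 / 8)) ≤ 1 ∧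
      (bigP D * bigP D) ^ 2 * Real.exp (-(ell D ^ 10 / 8)) ≤ 1 := by
  have hL1 : 1 ≤ ell D := by linarith
  have hTsq := bigT_sq_le hL1
  have hT0 : 0 < bigT D := Real.exp_pos _
  have hkey : 10 * ell D ^ 9 ≤ ell D ^ 10 / 8 := by
    have : ell D ^ 10 = ell D ^ 9 * ell D := by ring
    rw [this]
    have h9 : 0 < ell D ^ 9 := by positivity
    nlinarith
  have hsmall : 8 * ell D ^ 2 + 6 ≤ 8 * ell D ^ 9 := by
    have h7 : (2 : ℝ) ≤ ell D ^ 7 := by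
      calc (2 : ℝ) ≤ 80 ^ 7 := by norm_num
        _ ≤ ell D ^ 7 := pow_le_pow_left₀ (by norm_num) h80 7
    have h2 : (1 : ℝ) ≤ ell D ^ 2 := one_le_pow₀ hL1
    have h9 : ell D ^ 9 = ell D ^ 2 * ell D ^ 7 := by ring
    rw [h9]
    nlinarith
  have hP0 : 0 ≤ bigP D := (Real.exp_pos _).le
  constructor
  · have h1 : 3 * bigT D ^ 2 * (3 * bigT D ^ 2) * bigP D ≤
        Real.exp 3 * Real.exp (4 * ell D ^ 2) * Real.exp (ell D ^ 9) := by
      have h9 : (9 : ℝ) ≤ Real.exp 3 := by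
        have he := Real.exp_one_gt_d9
        have h3 : Real.exp 3 = Real.exp 1 * Real.exp 1 * Real.exp 1 := by
          rw [← Real.exp_add, ← Real.exp_add]; norm_num
        rw [h3]; nlinarith [Real.exp_pos (1 : ℝ)]
      calc 3 * bigT D ^ 2 * (3 * bigT D ^ 2) * bigP D = 9 * (bigT D ^ 2 * bigT D ^ 2) * bigP D := by ring
        _ ≤ Real.exp 3 * (Real.exp (2 * ell D ^ 2) * Real.exp (2 * ell D ^ 2)) * bigP D := by
            gcongr
        _ = Real.exp 3 * Real.exp (4 * ell D ^ 2) * Real.exp (ell D ^ 9) := by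
            rw [← Real.exp_add, bigP]; ring_nf
    have h0 : 0 ≤ 3 * bigT D ^ 2 * (3 * bigT D ^ 2) * bigP D := mul_nonneg (by positivity) hP0
    calc (3 * bigT D ^ 2 * (3 * bigT D ^ 2) * bigP D) ^ 2 * Real.exp (-(ell D ^ 10 / 8))
        ≤ (Real.exp 3 * Real.exp (4 * ell D ^ 2) * Real.exp (ell D ^ 9)) ^ 2 *
            Real.exp (-(ell D ^ 10 / 8)) := by gcongr
      _ = Real.exp (6 + 8 * ell D ^ 2 + 2 * ell D ^ 9 - ell D ^ 10 / 8) := by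
          rw [← Real.exp_add, ← Real.exp_add, sq, ← Real.exp_add, ← Real.exp_add]; ring_nf
      _ ≤ Real.exp 0 := Real.exp_le_exp.mpr (by linarith)
      _ = 1 := Real.exp_zero
  · calc (bigP D * bigP D) ^ 2 * Real.exp (-(ell D ^ 10 / 8))
        = Real.exp (4 * ell D ^ 9 - ell D ^ 10 / 8) := by
          rw [bigP, ← Real.exp_add, sq, ← Real.exp_add, ← Real.exp_add]; ring_nf
      _ ≤ Real.exp 0 := Real.exp_le_exp.mpr (by nlinarith [pow_nonneg (by linarith : (0:ℝ) ≤ ell D) 9])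
      _ = 1 := Real.exp_zero

end Sizes

/-! ## D. The remainder estimate -/

/-- The threshold `D ≥ ⌈e^{L₀}⌉` gives `L₀ ≤ 𝓛`. [folklore] -/
private theorem threshold_le_ell' {L₀ : ℝ} {D : ℕ} (hD : ⌈Real.exp L₀⌉₊ ≤ D) : L₀ ≤ ell D := by
  have h1 : Real.exp L₀ ≤ D := (Nat.le_ceil _).trans (by exact_mod_cast hD)
  have hD0 : (0 : ℝ) < D := (Real.exp_pos _).trans_le h1
  rw [ell, Real.le_log_iff_exp_le hD0]; exact h1

/-- Cauchy's inequality on a finite double sum with non-negative weights: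
`ΣΣ w·a·b ≤ (ΣΣ w·a²)^{1/2}(ΣΣ w·b²)^{1/2}`. [folklore] -/
private theorem sum_sum_mul_mul_le_sqrt {α β : Type*} (S : Finset α) (Tρ : α → Finset β)
    (w a b : α → β → ℝ) (hw : ∀ x y, 0 ≤ w x y) :
    (∑ x ∈ S, ∑ y ∈ Tρ x, w x y * a x y * b x y) ≤
      Real.sqrt (∑ x ∈ S, ∑ y ∈ Tρ x, w x y * a x y ^ 2) *
        Real.sqrt (∑ x ∈ S, ∑ y ∈ Tρ x, w x y * b x y ^ 2) := by
  rw [← Finset.sum_sigma S Tρ (fun i => w i.1 i.2 * a i.1 i.2 * b i.1 i.2),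
    ← Finset.sum_sigma S Tρ (fun i => w i.1 i.2 * a i.1 i.2 ^ 2),
    ← Finset.sum_sigma S Tρ (fun i => w i.1 i.2 * b i.1 i.2 ^ 2)]
  have h := Real.sum_mul_le_sqrt_mul_sqrt (S.sigma Tρ)
    (fun i => Real.sqrt (w i.1 i.2) * a i.1 i.2) (fun i => Real.sqrt (w i.1 i.2) * b i.1 i.2)
  have h1 : ∀ i : (Σ _ : α, β), Real.sqrt (w i.1 i.2) * a i.1 i.2 * (Real.sqrt (w i.1 i.2) * b i.1 i.2) =
      w i.1 i.2 * a i.1 i.2 * b i.1 i.2 := fun i => by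
    have := Real.mul_self_sqrt (hw i.1 i.2)
    calc Real.sqrt (w i.1 i.2) * a i.1 i.2 * (Real.sqrt (w i.1 i.2) * b i.1 i.2)
        = (Real.sqrt (w i.1 i.2) * Real.sqrt (w i.1 i.2)) * a i.1 i.2 * b i.1 i.2 := by ring
      _ = w i.1 i.2 * a i.1 i.2 * b i.1 i.2 := by rw [this]
  have h2 : ∀ (c : α → β → ℝ) (i : (Σ _ : α, β)), (Real.sqrt (w i.1 i.2) * c i.1 i.2) ^ 2 =
      w i.1 i.2 * c i.1 i.2 ^ 2 := fun c i => by
    rw [mul_pow, Real.sq_sqrt (hw i.1 i.2)]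
  simp only [h1, h2] at h
  exact h

set_option maxHeartbeats 800000 in
/-- **The Lemma-4.8 remainder sum, core estimate** (§13 p.75; R-19): for `c′ ≥ 0` with
`Skeleton.Prop22 c′` there is `C ≥ 0` such that for all large `D` and every real primitive `χ`,
`Σ_{ψ∈Ψ₁}Σ_{ρ∈𝔷(ψ)} ‖L(ρ+β₁,ψ)N(ρ+β₂,ψ)N(ρ+β₃,ψ)B(ρ,ψ)/L′(ρ,ψ)‖·|ω(ρ)| ≤ C·𝔓·𝓛³¹`
(explicit exponent `31 = 9 + (17 + 45)/2 − 9`, i.e. Lemma 5.9's `log P` plus half of the two coefficient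
exponents `8` and `36`; no Assumption (A)). Cauchy on the positive weights `|L(ρ+β₁)/L′(ρ)|·|ω(ρ)|`,
then `zeroSum_dirPoly_sq_le_of_prop22` twice (`N₂N₃` with `c₁ = u₂′ ⋆ u₃′`, `B` with `bχ`), the
logarithmic coefficient sums of `Section13MeanSquareTools`, and the sizes of §C.
[cite: Zhang2022LandauSiegel, §13 (13.7), (13.11) p.75, tex L3774–L3817] -/
theorem rem137_core_of_prop22 {c' : ℝ} (hc' : 0 ≤ c') (h22 : Prop22 c') :
    ∃ C : ℝ, 0 ≤ C ∧ ForAllLarge fun D _ χ =>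
      (∑ x ∈ finsetOf (PsiOne χ), ∑ ρ ∈ finsetOf (zeroSet D x),
          ‖x.ψ.LFunction (ρ + beta1 c' D) * Nchar D (psiFn x) (ρ + beta2 c' D) *
              Nchar D (psiFn x) (ρ + beta3 c' D) * Bpoly χ x ρ / deriv x.ψ.LFunction ρ‖ *
            ‖omegaW D ρ‖) ≤ C * frakP D * ell D ^ 31 := by
  obtain ⟨K, hK0, C, hC0, D₁, hG⟩ := zeroSum_dirPoly_sq_le_of_prop22 hc' h22
  set βb : ℝ := (1 + ‖iota2‖) * (‖iota3‖ + ‖iota4‖) with hβb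
  have hβb0 : 0 ≤ βb := by positivity
  have hm42 : 0 ≤ majorantConst 4 2 := (majorantConst_pos 4 2).le
  have hm44 : 0 ≤ majorantConst 4 4 := (majorantConst_pos 4 4).le
  set A₀ : ℝ := C * (2 * Real.exp (8 * π) * (majorantConst 4 2 * 81)) + K with hA₀
  set B₀ : ℝ := C * (2 * Real.exp (8 * π) * (βb ^ 2 * majorantConst 4 4)) + K * βb ^ 2 with hB₀
  have hA₀0 : 0 ≤ A₀ := by positivity
  have hB₀0 : 0 ≤ B₀ := by positivity
  refine ⟨Real.sqrt (A₀ * B₀), Real.sqrt_nonneg _, max D₁ ⌈Real.exp 80⌉₊, fun D _ χ hD hq hp => ?_⟩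
  have hD₁ : D₁ ≤ D := (le_max_left _ _).trans hD
  have h80 : 80 ≤ ell D := threshold_le_ell' ((le_max_right _ _).trans hD)
  have hL1 : 1 ≤ ell D := by linarith
  have hL2 : 2 ≤ ell D := by linarith
  have hL3 : 3 ≤ ell D := by linarith
  have hℓpos : 0 < ell D := by linarith
  have hP0 : 0 ≤ frakP D := frakP_nonneg D
  have hbigP0 : 0 ≤ bigP D := (Real.exp_pos _).le
  obtain ⟨hM2, hMle, hKM, hlogM⟩ := sizes_M hL2
  obtain ⟨hP2, hlogP⟩ := sizes_P hL2
  obtain ⟨herr1, herr2⟩ := sizes_err h80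
  have hGD := hG D χ hD₁ hq hp
  have hflP : ((⌊bigP D⌋₊ : ℕ) : ℝ) ≤ bigP D ^ 2 := (floor_bigP_le_sq D).1
  -- names
  set T := finsetOf (PsiOne χ) with hT
  set M := ⌈2 * bigT D ^ 2⌉₊ with hM
  set u₂ : ℕ → ℂ := fun n => if n < M then
    ((gstar D (bigT D ^ 2 / n) : ℝ) : ℂ) * (n : ℂ) ^ (-beta2 c' D) else 0 with hu₂
  set u₃ : ℕ → ℂ := fun n => if n < M then
    ((gstar D (bigT D ^ 2 / n) : ℝ) : ℂ) * (n : ℂ) ^ (-beta3 c' D) else 0 with hu₃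
  set c₁ : ℕ → ℂ := seqConv u₂ u₃ with hc₁
  set c₂ : ℕ → ℂ := fun k => bcoef D k * χ (k : ZMod D) with hc₂
  set w : Chr D → ℂ → ℝ := fun x ρ =>
    ‖x.ψ.LFunction (ρ + beta1 c' D) / deriv x.ψ.LFunction ρ‖ * ‖omegaW D ρ‖ with hw
  set a : Chr D → ℂ → ℝ := fun x ρ =>
    ‖Nchar D (psiFn x) (ρ + beta2 c' D) * Nchar D (psiFn x) (ρ + beta3 c' D)‖ with ha
  set b : Chr D → ℂ → ℝ := fun x ρ => ‖Bpoly χ x ρ‖ with hb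
  have hw0 : ∀ x ρ, 0 ≤ w x ρ := fun x ρ => by positivity
  -- the weighted coefficient sums
  have hS : ∀ (c : ℕ → ℂ) {S₀ : ℝ}, (∑ k ∈ Icc 1 ⌊bigP D⌋₊, ‖c k‖ ^ 2 / k ≤ S₀) →
      (∑ n ∈ Icc 1 ⌊bigP D⌋₊,
        ‖c n‖ ^ 2 * ((n : ℝ) ^ (-(1 + 2 * alpha D)) + (n : ℝ) ^ (-(1 - 2 * alpha D)))) ≤
        2 * Real.exp (8 * π) * S₀ := by
    intro c S₀ hS₀
    have hα0 : 0 ≤ alpha D := by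
      rw [alpha, bigP, Real.log_exp]; exact (div_pos Real.pi_pos (pow_pos hℓpos 9)).le
    have hσp : |(1 / 2 + alpha D) - 1 / 2| ≤ 2 * alpha D := by
      rw [show (1 : ℝ) / 2 + alpha D - 1 / 2 = alpha D by ring, abs_of_nonneg hα0]; linarith
    have hσm : |(1 / 2 - alpha D) - 1 / 2| ≤ 2 * alpha D := by
      rw [show (1 : ℝ) / 2 - alpha D - 1 / 2 = -alpha D by ring, abs_neg, abs_of_nonneg hα0]; linarith
    have hsp := sum_norm_sq_rpow_le hL1 hσp hflP c
    have hsm := sum_norm_sq_rpow_le hL1 hσm hflP c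
    have he : ∀ n : ℕ, ‖c n‖ ^ 2 * ((n : ℝ) ^ (-(1 + 2 * alpha D)) + (n : ℝ) ^ (-(1 - 2 * alpha D))) =
        ‖c n‖ ^ 2 * (n : ℝ) ^ (-2 * (1 / 2 + alpha D)) + ‖c n‖ ^ 2 * (n : ℝ) ^ (-2 * (1 / 2 - alpha D)) := by
      intro n
      rw [show -(1 + 2 * alpha D) = -2 * (1 / 2 + alpha D) by ring,
        show -(1 - 2 * alpha D) = -2 * (1 / 2 - alpha D) by ring]
      ring
    simp only [he]
    rw [Finset.sum_add_distrib]
    have hmul := mul_le_mul_of_nonneg_left hS₀ (Real.exp_pos (8 * π)).le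
    linarith
  -- (1) the summand as `w·a·b`
  have hsummand : ∀ (x : Chr D) (ρ : ℂ),
      ‖x.ψ.LFunction (ρ + beta1 c' D) * Nchar D (psiFn x) (ρ + beta2 c' D) *
          Nchar D (psiFn x) (ρ + beta3 c' D) * Bpoly χ x ρ / deriv x.ψ.LFunction ρ‖ * ‖omegaW D ρ‖ =
        w x ρ * a x ρ * b x ρ := by
    intro x ρ
    simp only [hw, ha, hb]
    rw [norm_div, norm_mul, norm_mul, norm_mul, norm_div, norm_mul]
    ring
  simp_rw [hsummand]
  -- (2) Cauchy
  refine (sum_sum_mul_mul_le_sqrt T (fun x => finsetOf (zeroSet D x)) w a b hw0).trans ?_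
  -- (3) the `N₂N₃` quadratic sum
  have hA : (∑ x ∈ T, ∑ ρ ∈ finsetOf (zeroSet D x), w x ρ * a x ρ ^ 2) ≤
      A₀ * frakP D * ell D ^ 17 := by
    have hre : (∑ x ∈ T, ∑ ρ ∈ finsetOf (zeroSet D x), w x ρ * a x ρ ^ 2) =
        ∑ x ∈ T, ∑ ρ ∈ finsetOf (zeroSet D x),
          ‖x.ψ.LFunction (ρ + beta1 c' D) / deriv x.ψ.LFunction ρ‖ *
            ‖∑ n ∈ Icc 1 ⌊bigP D⌋₊, c₁ n * x.ψ (n : ZMod x.p) * (n : ℂ) ^ (-ρ)‖ ^ 2 *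
              ‖omegaW D ρ‖ := by
      refine Finset.sum_congr rfl fun x _ => Finset.sum_congr rfl fun ρ _ => ?_
      simp only [hw, ha]
      rw [Nchar_mul_Nchar_eq_dirPoly c' x hKM ρ]
      ring
    rw [hre]
    have hG1 := hGD c₁ ((M * M : ℕ) : ℝ) (by positivity) (fun n => norm_NNcoeff_le c' hℓpos n)
    refine hG1.trans ?_
    -- coefficient sum
    have hc₁S : ∑ k ∈ Icc 1 ⌊bigP D⌋₊, ‖c₁ k‖ ^ 2 / k ≤ majorantConst 4 2 * (81 * ell D ^ 8) := by
      have h := sum_norm_seqConv_short_short_sq_div_le (dom_Ncoeff hℓpos (beta2_re c' D))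
        (dom_Ncoeff hℓpos (beta3_re c' D)) hM2 hP2
      exact h.trans (mul_le_mul_of_nonneg_left hlogM hm42)
    have hS₁ := hS c₁ hc₁S
    -- error term
    have hE₁ : K * frakP D * (((M * M : ℕ) : ℝ) * bigP D) ^ 2 * Real.exp (-(ell D ^ 10 / 8)) ≤
        K * frakP D := by
      have hMM : (((M * M : ℕ) : ℝ) * bigP D) ^ 2 * Real.exp (-(ell D ^ 10 / 8)) ≤ 1 := by
        have h1 : ((M * M : ℕ) : ℝ) * bigP D ≤ 3 * bigT D ^ 2 * (3 * bigT D ^ 2) * bigP D := by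
          push_cast
          exact mul_le_mul_of_nonneg_right (mul_le_mul hMle hMle (Nat.cast_nonneg _) (by positivity))
            hbigP0
        have h0 : 0 ≤ ((M * M : ℕ) : ℝ) * bigP D := by positivity
        calc (((M * M : ℕ) : ℝ) * bigP D) ^ 2 * Real.exp (-(ell D ^ 10 / 8))
            ≤ (3 * bigT D ^ 2 * (3 * bigT D ^ 2) * bigP D) ^ 2 * Real.exp (-(ell D ^ 10 / 8)) := by
              gcongr
          _ ≤ 1 := herr1
      calc K * frakP D * (((M * M : ℕ) : ℝ) * bigP D) ^ 2 * Real.exp (-(ell D ^ 10 / 8))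
          = K * frakP D * ((((M * M : ℕ) : ℝ) * bigP D) ^ 2 * Real.exp (-(ell D ^ 10 / 8))) := by ring
        _ ≤ K * frakP D * 1 := mul_le_mul_of_nonneg_left hMM (mul_nonneg hK0 hP0)
        _ = K * frakP D := mul_one _
    have h17 : ell D ^ 9 * ell D ^ 8 = ell D ^ 17 := by ring
    have h1le : (1 : ℝ) ≤ ell D ^ 17 := one_le_pow₀ hL1
    calc C * ell D ^ 9 * frakP D * (∑ n ∈ Icc 1 ⌊bigP D⌋₊,
            ‖c₁ n‖ ^ 2 * ((n : ℝ) ^ (-(1 + 2 * alpha D)) + (n : ℝ) ^ (-(1 - 2 * alpha D)))) +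
          K * frakP D * (((M * M : ℕ) : ℝ) * bigP D) ^ 2 * Real.exp (-(ell D ^ 10 / 8))
        ≤ C * ell D ^ 9 * frakP D * (2 * Real.exp (8 * π) * (majorantConst 4 2 * (81 * ell D ^ 8))) +
          K * frakP D := by
          gcongr
      _ = C * (2 * Real.exp (8 * π) * (majorantConst 4 2 * 81)) * frakP D * ell D ^ 17 +
          K * frakP D * 1 := by rw [← h17]; ring
      _ ≤ C * (2 * Real.exp (8 * π) * (majorantConst 4 2 * 81)) * frakP D * ell D ^ 17 +
          K * frakP D * ell D ^ 17 := by gcongr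
      _ = A₀ * frakP D * ell D ^ 17 := by rw [hA₀]; ring
  -- (4) the `B` quadratic sum
  have hB : (∑ x ∈ T, ∑ ρ ∈ finsetOf (zeroSet D x), w x ρ * b x ρ ^ 2) ≤
      B₀ * frakP D * ell D ^ 45 := by
    have hre : (∑ x ∈ T, ∑ ρ ∈ finsetOf (zeroSet D x), w x ρ * b x ρ ^ 2) =
        ∑ x ∈ T, ∑ ρ ∈ finsetOf (zeroSet D x),
          ‖x.ψ.LFunction (ρ + beta1 c' D) / deriv x.ψ.LFunction ρ‖ *
            ‖∑ n ∈ Icc 1 ⌊bigP D⌋₊, c₂ n * x.ψ (n : ZMod x.p) * (n : ℂ) ^ (-ρ)‖ ^ 2 *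
              ‖omegaW D ρ‖ := by
      refine Finset.sum_congr rfl fun x _ => Finset.sum_congr rfl fun ρ _ => ?_
      simp only [hw, hb]
      rw [Bpoly_eq_dirPolyIcc χ x hL3 ρ]
      ring
    rw [hre]
    have hG2 := hGD c₂ (βb * bigP D) (by positivity) (fun n => norm_bcoef_chi_le_P χ hL3 n)
    refine hG2.trans ?_
    have hc₂S : ∑ k ∈ Icc 1 ⌊bigP D⌋₊, ‖c₂ k‖ ^ 2 / k ≤ βb ^ 2 * (majorantConst 4 4 * ell D ^ 36) := by
      have h := sum_norm_sq_div_le_of_dom_tau_two (dom_bcoef_chi χ (by rw [ell] at hL2; exact hL2)) hP2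
      refine h.trans (mul_le_mul_of_nonneg_left (mul_le_mul_of_nonneg_left hlogP hm44) (sq_nonneg _))
    have hS₂ := hS c₂ hc₂S
    have hE₂ : K * frakP D * (βb * bigP D * bigP D) ^ 2 * Real.exp (-(ell D ^ 10 / 8)) ≤
        K * frakP D * βb ^ 2 := by
      calc K * frakP D * (βb * bigP D * bigP D) ^ 2 * Real.exp (-(ell D ^ 10 / 8))
          = K * frakP D * βb ^ 2 * ((bigP D * bigP D) ^ 2 * Real.exp (-(ell D ^ 10 / 8))) := by ring
        _ ≤ K * frakP D * βb ^ 2 * 1 :=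
            mul_le_mul_of_nonneg_left herr2 (mul_nonneg (mul_nonneg hK0 hP0) (sq_nonneg _))
        _ = K * frakP D * βb ^ 2 := mul_one _
    have h45 : ell D ^ 9 * ell D ^ 36 = ell D ^ 45 := by ring
    have h1le : (1 : ℝ) ≤ ell D ^ 45 := one_le_pow₀ hL1
    calc C * ell D ^ 9 * frakP D * (∑ n ∈ Icc 1 ⌊bigP D⌋₊,
            ‖c₂ n‖ ^ 2 * ((n : ℝ) ^ (-(1 + 2 * alpha D)) + (n : ℝ) ^ (-(1 - 2 * alpha D)))) +
          K * frakP D * (βb * bigP D * bigP D) ^ 2 * Real.exp (-(ell D ^ 10 / 8))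
        ≤ C * ell D ^ 9 * frakP D * (2 * Real.exp (8 * π) * (βb ^ 2 * (majorantConst 4 4 * ell D ^ 36))) +
          K * frakP D * βb ^ 2 := by
          gcongr
      _ = C * (2 * Real.exp (8 * π) * (βb ^ 2 * majorantConst 4 4)) * frakP D * ell D ^ 45 +
          K * βb ^ 2 * frakP D * 1 := by rw [← h45]; ring
      _ ≤ C * (2 * Real.exp (8 * π) * (βb ^ 2 * majorantConst 4 4)) * frakP D * ell D ^ 45 +
          K * βb ^ 2 * frakP D * ell D ^ 45 := by gcongr
      _ = B₀ * frakP D * ell D ^ 45 := by rw [hB₀]; ring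
  -- (5) combine
  have hA0 : 0 ≤ ∑ x ∈ T, ∑ ρ ∈ finsetOf (zeroSet D x), w x ρ * a x ρ ^ 2 :=
    Finset.sum_nonneg fun x _ => Finset.sum_nonneg fun ρ _ => by positivity
  have hB0 : 0 ≤ ∑ x ∈ T, ∑ ρ ∈ finsetOf (zeroSet D x), w x ρ * b x ρ ^ 2 :=
    Finset.sum_nonneg fun x _ => Finset.sum_nonneg fun ρ _ => by positivity
  calc Real.sqrt (∑ x ∈ T, ∑ ρ ∈ finsetOf (zeroSet D x), w x ρ * a x ρ ^ 2) *
        Real.sqrt (∑ x ∈ T, ∑ ρ ∈ finsetOf (zeroSet D x), w x ρ * b x ρ ^ 2)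
      ≤ Real.sqrt (A₀ * frakP D * ell D ^ 17) * Real.sqrt (B₀ * frakP D * ell D ^ 45) :=
        mul_le_mul (Real.sqrt_le_sqrt hA) (Real.sqrt_le_sqrt hB) (Real.sqrt_nonneg _)
          (Real.sqrt_nonneg _)
    _ = Real.sqrt (A₀ * B₀ * (frakP D * ell D ^ 31) ^ 2) := by
        rw [← Real.sqrt_mul (by positivity)]
        congr 1
        ring
    _ = Real.sqrt (A₀ * B₀) * (frakP D * ell D ^ 31) := by
        rw [Real.sqrt_mul' _ (by positivity), Real.sqrt_sq (by positivity)]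
    _ = Real.sqrt (A₀ * B₀) * frakP D * ell D ^ 31 := by ring

/-! ## E. The `ε(𝔞+1)𝔓` forms (hypothesis #2 of `eval137Rel_of_repaired`) and the h137 bypass edge -/

/-- **Rem137 from Proposition 2.2** — hypothesis #2 of `Typed.Section13.eval137Rel_of_repaired`
VERBATIM, at a given `c′ ≥ 0` with `Skeleton.Prop22 c′`: for every `ε > 0`, for all large `D` (under
(A), unused), `𝓛⁻¹⁰⁰·Σ_{(ψ,ρ)}‖L(ρ+β₁,ψ)N(ρ+β₂,ψ)N(ρ+β₃,ψ)B(ρ,ψ)/L′(ρ,ψ)‖·|ω(ρ)| ≤ ε(𝔞+1)𝔓`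
(`rem137_core_of_prop22`: the sum is `≤ C𝔓𝓛³¹`, and `C𝓛⁻⁶⁹ ≤ ε` once `𝓛 ≥ C/ε + 1`; `𝔞 ≥ 0`).
[cite: Zhang2022LandauSiegel, §13 (13.7), (13.11) p.75] -/
theorem rem137_of_prop22 {c' : ℝ} (hc' : 0 ≤ c') (h22 : Prop22 c') :
    ∀ ε : ℝ, 0 < ε → ForAllLarge fun D _ χ => AssumptionA D χ →
      (ell D ^ 100)⁻¹ * (∑ i ∈ idx χ,
          ‖i.1.ψ.LFunction (i.2 + beta1 c' D) * Nchar D (psiFn i.1) (i.2 + beta2 c' D) *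
              Nchar D (psiFn i.1) (i.2 + beta3 c' D) * Bpoly χ i.1 i.2 /
              deriv i.1.ψ.LFunction i.2‖ * ‖omegaW D i.2‖) ≤ ε * (frakA χ + 1) * frakP D := by
  intro ε hε
  obtain ⟨C, hC0, D₁, hcore⟩ := rem137_core_of_prop22 hc' h22
  refine ⟨max D₁ ⌈Real.exp (C / ε + 1)⌉₊, fun D _ χ hD hq hp _ => ?_⟩
  have hD₁ : D₁ ≤ D := (le_max_left _ _).trans hD
  have hℓ : C / ε + 1 ≤ ell D := threshold_le_ell' ((le_max_right _ _).trans hD)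
  have hCε : 0 ≤ C / ε := div_nonneg hC0 hε.le
  have hℓ1 : 1 ≤ ell D := by linarith
  have hℓpos : 0 < ell D := by linarith
  have h := hcore D χ hD₁ hq hp
  have hP0 : 0 ≤ frakP D := frakP_nonneg D
  have hA0 : 0 ≤ frakA χ := frakA_nonneg χ
  rw [idx, Finset.sum_sigma]
  -- `C𝓛³¹/𝓛¹⁰⁰ = C/𝓛⁶⁹ ≤ ε`
  have h69 : ell D ≤ ell D ^ 69 := le_self_pow₀ hℓ1 (by norm_num)
  have hCle : C ≤ ε * ell D ^ 69 := by
    have h1 : C / ε < ell D := by linarith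
    rw [div_lt_iff₀ hε] at h1
    nlinarith
  have h100 : (0 : ℝ) < ell D ^ 100 := pow_pos hℓpos 100
  calc (ell D ^ 100)⁻¹ * (∑ x ∈ finsetOf (PsiOne χ), ∑ ρ ∈ finsetOf (zeroSet D x),
          ‖x.ψ.LFunction (ρ + beta1 c' D) * Nchar D (psiFn x) (ρ + beta2 c' D) *
              Nchar D (psiFn x) (ρ + beta3 c' D) * Bpoly χ x ρ / deriv x.ψ.LFunction ρ‖ *
            ‖omegaW D ρ‖)
      ≤ (ell D ^ 100)⁻¹ * (C * frakP D * ell D ^ 31) :=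
        mul_le_mul_of_nonneg_left h (inv_nonneg.mpr h100.le)
    _ = (C * frakP D) * (ell D ^ 31 / ell D ^ 100) := by rw [div_eq_mul_inv]; ring
    _ = (C * frakP D) / ell D ^ 69 := by
        rw [show ell D ^ 100 = ell D ^ 31 * ell D ^ 69 by ring, div_mul_eq_div_div,
          div_self (pow_ne_zero _ hℓpos.ne'), one_div, div_eq_mul_inv]
    _ ≤ (ε * ell D ^ 69 * frakP D) / ell D ^ 69 := by
        gcongr
    _ = ε * frakP D := by field_simp
    _ ≤ ε * (frakA χ + 1) * frakP D := by
        have : ε * frakP D * 1 ≤ ε * frakP D * (frakA χ + 1) :=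
          mul_le_mul_of_nonneg_left (by linarith) (mul_nonneg hε.le hP0)
        linarith

/-- **Rem137 for every sufficiently large `c′`, NO hypothesis** (Prop. 2.2 is a tree theorem for large
`c′`: `Skeleton.prop22_eventually`) — the threshold form of the typer's scratch signature.
[cite: Zhang2022LandauSiegel, §13 (13.7), (13.11) p.75] -/
theorem rem137_eventually : ∃ k : ℝ, ∀ c' : ℝ, k ≤ c' →
    ∀ ε : ℝ, 0 < ε → ForAllLarge fun D _ χ => AssumptionA D χ →
      (ell D ^ 100)⁻¹ * (∑ i ∈ idx χ,
          ‖i.1.ψ.LFunction (i.2 + beta1 c' D) * Nchar D (psiFn i.1) (i.2 + beta2 c' D) *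
              Nchar D (psiFn i.1) (i.2 + beta3 c' D) * Bpoly χ i.1 i.2 /
              deriv i.1.ψ.LFunction i.2‖ * ‖omegaW D i.2‖) ≤ ε * (frakA χ + 1) * frakP D := by
  obtain ⟨c₀, hc₀, h⟩ := prop22_eventually
  exact ⟨c₀, fun c' hc' => rem137_of_prop22 (hc₀.trans hc') (h c' hc')⟩

/-- **The h137 BYPASS EDGE (R-19), constant-free form**: there are `c₁ > 0` (Lemma 6.1's constant,
through `eval137Rel_of_repaired`) and a threshold `k` such that for every `c₀ ≤ c₁` and every `c′ ≥ k`,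
the relative (13.11) `Skeleton.Eq1311Rel c′ c₀` ALONE implies the consumed node
`Skeleton.Eval137Rel c′` — the repaired (13.7) (`eq137c_holds`) and the Lemma-4.8 remainder
(`rem137_eventually`) being theorems. The named-constant edge of record (R-21, `c₀ := c137`) is the
specialisation of this one. [cite: Zhang2022LandauSiegel, §13 (13.7), (13.11) p.75] -/
theorem eval137Rel_of_1311Rel_le : ∃ c₁ : ℝ, 0 < c₁ ∧ ∃ k : ℝ, ∀ c₀ : ℝ, c₀ ≤ c₁ →
    ∀ c' : ℝ, k ≤ c' → Eq1311Rel c' c₀ → Eval137Rel c' := by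
  obtain ⟨c₁, hc₁, h⟩ := eval137Rel_of_repaired
  obtain ⟨k, hk⟩ := rem137_eventually
  exact ⟨c₁, hc₁, k, fun c₀ hc₀ c' hc' h1311 => h c₀ hc₀ c' h1311 (hk c' hc')⟩

end Literature.NumberTheory.LFunctions.Zhang2022.Typed.Section13

end
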